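import Summits.BirchSwinnertonDyer.BirchSwinnertonDyer.Theorems.EisensteinPrimesCharResidualSelmerFinite
import Summits.BirchSwinnertonDyer.BirchSwinnertonDyer.Theorems.EisensteinPrimesResidualPairStableLine
import Summits.BirchSwinnertonDyer.BirchSwinnertonDyer.Theorems.EisensteinPrimesKellerYinLemma511IffResidualFinite
import Summits.BirchSwinnertonDyer.BirchSwinnertonDyer.Theorems.EisensteinPrimesGoodLatticeQuotCharUnramified
import Literature.NumberTheory.EllipticCurves.AnticyclotomicPrimeDecompositionAboveProofs
import Literature.NumberTheory.EllipticCurves.KellerYin2024.AnomalousImprimitiveLambdaInvariants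
import HarnessLib

/-!
# Keller–Yin Thm. 1.4.1, COTORSION CLAUSES, in the kernel: `𝔛_f^{Sf}` and `𝔛_f` are finitely generated
# `Λ`-torsion with `μ = 0` at the residual pair, GIVEN the first clause of Prop. 1.2.5 for `ω̃` and `𝟙̃`
# (cell `bsd-eis`, seat `bsd-line-x1-p1` LEAD g3, D-0154 KEY row 4; crux 2 `GoodLatticeBDPValue`
# stmt-BirchSwinnertonDyer-19032, line `halves` v17 → v18, stub `stub_imprim`)

HONEST FRAMING (cell `bsd-eis`, run/shared/lean/pub/bsd-eis/): an unconditional kernel theorem whose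
HYPOTHESES `hSsub`/`hSquot` («every dual datum of `H¹_{𝓕_nr^{Sf}}(K_∞, (F/𝒪)(θ))` is finitely generated
`Λ`-torsion with `μ = 0`», `θ ∈ {ω̃, 𝟙̃}`) are exactly what the `halves` line already holds in the kernel
modulo PUBLISHED facts (`prop125_residualPair_unrSelmer_imprimitive` ⇐ [PWL-θ]-`≥` p631421 ∘ p611963 ∘
p569470, fed by [RH] from Rubin's two-variable main conjecture + de Shalit II.6.4 + Hida Thm. I,
`goodLattice_jointMuLambda_of_facts`). No definition, no named fact, no `sorry`, no `Theses` import;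
BSD / IMC2 / KY Thm. 1.4.1's `λ`-identity are proved for NO curve. Helper `--supports stmt-BirchSwinnertonDyer-19032`.

## What
`moduleFinite_isTorsion_muInvariant_eq_zero_of_forall_dualData`: for `E = W/ℚ`, `p > 2`, `K` imaginary
quadratic, `v̄ ∋ p`, `κ` anticyclotomic with topological generator `γ`, `(θsub, θquot)` a residual pair of
`E_K[p]` (`IsResidualPairOver`), `Sf` = the places over `N_E`: if every dual datum of the `Sf`-imprimitive
unramified Selmer groups of `(F/𝒪)(θsub)` and `(F/𝒪)(θquot)` over `K_∞` is f.g. `Λ`-torsion with `μ = 0`,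
then Castella's `𝔛_f^{Sf} = AcSelmer.XAc E_K p κ v̄ ↑Sf γ` and `𝔛_f = AcSelmer.XAc E_K p κ v̄ ∅ γ` are
finitely generated `Λ`-torsion with `μ = 0` — conjuncts (i) and (ii) of
`KellerYin2024.thm141_imprimlambda_goodLattice_OPEN`, VERBATIM. Proof = the residual dévissage:
`ResidualPairStableLine.exists_stableLine_of_isResidualPairOver` (the line `Φ ≅ 𝔽(ω̃)`,
`E_K[p]/Φ ≅ 𝔽(𝟙̃)`), `CharResidualSelmerFinite.finite_residualStrictSelmer_of_forall_dualData` (residual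
groups of the characters finite, by Pontryagin + Kummer), Brink (`v̄` finitely decomposed in `K_∞^{ac}`),
Néron–Ogg–Shafarevich off `Sf ∪ {w ∣ p}`, `ResidualDevissageFiniteKernel.finite_selmerAc_pTorsion_of_line_devissage_of_finite`
(p628626, NO non-anomalous clause) ⟹ `Sel_v̄^{Sf}(K_∞, E[p^∞])[p]` finite ⟹ Greenberg's criterion (A)
(`UniversalToricDescentAcDualMuZero`) and Castella's finite generation (`XAc.module_finite`); the
primitive `𝔛_f` by `KellerYinLemma511ResidualFinite.isTorsion_muInvariant_eq_zero_empty_of_residualFinite`.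
No `Good`/`Anom`/`Mult` hypothesis is used: the statement serves good anomalous (crux 2) and
multiplicative (crux 4) Eisenstein data alike.

References: [KellerYin2024] Thm. 1.4.1 (arXiv:2402.12781v2 TeX L1087–1098), Lemma 1.2.4, Prop. 1.2.5,
§1.3, Lemma 5.1.1; [CastellaGrossiLeeSkinner2022] §1.4 Props. 17–18; [Brink2007] Cor. 1;
[SilvermanAEC2009] Prop. VII.4.1 (a); [GreenbergLNM1716] §1 p. 60; [Castella2018] §2.1 Def. 2.2.
-/

set_option autoImplicit false
set_option linter.dupNamespace false -- the summit namespace `…BirchSwinnertonDyer.BirchSwinnertonDyer.Theorems` (Sub = Summit, D-0017) trips it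

noncomputable section

open scoped Classical

namespace Summit.BirchSwinnertonDyer.BirchSwinnertonDyer.Theorems.Thm141TorsionClauses

open NumberField IsDedekindDomain Field WeierstrassCurve
open Literature.NumberTheory.EllipticCurves Literature.NumberTheory.EllipticCurves.GreenbergSelmer
  Literature.NumberTheory.EllipticCurves.GreenbergVatsal2000 Literature.NumberTheory.GaloisRepresentations
  Literature.NumberTheory.EllipticCurves.KellerYin2024 Literature.NumberTheory.QuadraticFields
  Literature.NumberTheory.IwasawaTheory
  Summit.BirchSwinnertonDyer.Rank1Residual.X11b Summit.BirchSwinnertonDyer.Rank1Residual.X11b.AcSelmer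
  Summit.BirchSwinnertonDyer.BirchSwinnertonDyer.Theorems.EisensteinPrimesMuLambda

variable {p : ℕ} [hp : Fact p.Prime]

/-- **Keller–Yin Thm. 1.4.1, conjuncts (i)–(ii), from the first clause of Prop. 1.2.5 for the residual
pair.** `E = W/ℚ`, `2 < p`, `K` imaginary quadratic, `v̄ ∋ p`, `κ` anticyclotomic (topological generator
`γ`), `(θsub, θquot)` a residual pair of `E_K[p]`, `Sf` the places of `K` over `N_E`: if every dual datum
of `H¹_{𝓕_nr^{Sf}}(K_∞, (F/𝒪)(θ))` is finitely generated `Λ`-torsion with `μ = 0` for `θ = θsub` and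
`θ = θquot`, then `𝔛_f^{Sf}` and `𝔛_f` (Castella's `XAc … ↑Sf γ`, `XAc … ∅ γ`) are finitely generated
`Λ`-torsion with `μ = 0`. Residual dévissage along `0 → Φ → E_K[p] → E_K[p]/Φ → 0` with `Φ ≅ 𝔽(ω̃)`,
`E_K[p]/Φ ≅ 𝔽(𝟙̃)`; character residual groups finite by Pontryagin + Kummer; Brink; Néron–Ogg–Shafarevich;
Greenberg's criterion (A). [cite: KellerYin2024, Thm. 1.4.1 ("Furthermore, 𝔛^S_f and 𝔛_f are both Λ-torsion with μ-invariants 0"; arXiv:2402.12781v2 TeX L1087–1098), Prop. 1.2.5, Lemma 1.2.4]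
[cite: CastellaGrossiLeeSkinner2022, §1.4 Props. 17–18 (arXiv:2008.02571)] [cite: Brink2007, Cor. 1]
[cite: SilvermanAEC2009, Prop. VII.4.1(a)] [cite: GreenbergLNM1716, §1 p. 60] -/
theorem moduleFinite_isTorsion_muInvariant_eq_zero_of_forall_dualData
    (W : WeierstrassCurve ℚ) [W.IsElliptic] (hp2 : 2 < p)
    (K : Type) [Field K] [NumberField K] (hK : IsImaginaryQuadratic K)
    (vbar : HeightOneSpectrum (𝓞 K)) (hvbar : ((p : ℕ) : 𝓞 K) ∈ vbar.asIdeal)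
    (κ : ZpExtension K p) (hκ : κ.IsAnticyclotomic)
    (γ : absoluteGaloisGroup K) [hγ : Fact (κ.IsTopGenerator γ)]
    {θsub θquot : FramedGaloisRep K (padicCoeffIntegers (∅ : Set (PadicAlgCl p))) 1}
    (hpair : IsResidualPairOver (W.baseChange K) p θsub θquot)
    (Sf : Finset (HeightOneSpectrum (𝓞 K)))
    (hSf : ∀ w : HeightOneSpectrum (𝓞 K), w ∈ Sf ↔ ((W.conductorNorm ℤ : ℤ) : 𝓞 K) ∈ w.asIdeal)
    (hSsub : ∀ D : DatumDualData κ γ (charModule (∅ : Set (PadicAlgCl p)) θsub)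
      (Literature.NumberTheory.EllipticCurves.Castella2018.AcSelmer.bdpData
        (charModule (∅ : Set (PadicAlgCl p)) θsub) p vbar) (↑Sf : Set (HeightOneSpectrum (𝓞 K))),
      Module.Finite (IwasawaAlgebra p) D.X ∧ Module.IsTorsion (IwasawaAlgebra p) D.X ∧
        muInvariant p D.X = 0)
    (hSquot : ∀ D : DatumDualData κ γ (charModule (∅ : Set (PadicAlgCl p)) θquot)
      (Literature.NumberTheory.EllipticCurves.Castella2018.AcSelmer.bdpData
        (charModule (∅ : Set (PadicAlgCl p)) θquot) p vbar) (↑Sf : Set (HeightOneSpectrum (𝓞 K))),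
      Module.Finite (IwasawaAlgebra p) D.X ∧ Module.IsTorsion (IwasawaAlgebra p) D.X ∧
        muInvariant p D.X = 0) :
    (Module.Finite (IwasawaAlgebra p)
        (Literature.NumberTheory.EllipticCurves.Castella2018.AcSelmer.XAc (W.baseChange K) p κ vbar
          (↑Sf : Set (HeightOneSpectrum (𝓞 K))) γ) ∧
      Module.IsTorsion (IwasawaAlgebra p)
        (Literature.NumberTheory.EllipticCurves.Castella2018.AcSelmer.XAc (W.baseChange K) p κ vbar
          (↑Sf : Set (HeightOneSpectrum (𝓞 K))) γ) ∧
      muInvariant p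
        (Literature.NumberTheory.EllipticCurves.Castella2018.AcSelmer.XAc (W.baseChange K) p κ vbar
          (↑Sf : Set (HeightOneSpectrum (𝓞 K))) γ) = 0) ∧
    (Module.Finite (IwasawaAlgebra p)
        (Literature.NumberTheory.EllipticCurves.Castella2018.AcSelmer.XAc (W.baseChange K) p κ vbar ∅ γ) ∧
      Module.IsTorsion (IwasawaAlgebra p)
        (Literature.NumberTheory.EllipticCurves.Castella2018.AcSelmer.XAc (W.baseChange K) p κ vbar ∅ γ) ∧
      muInvariant p
        (Literature.NumberTheory.EllipticCurves.Castella2018.AcSelmer.XAc (W.baseChange K) p κ vbar ∅ γ) =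
          0) := by
  haveI hEK : (W.baseChange K).IsElliptic := inferInstanceAs (W.map (algebraMap ℚ K)).IsElliptic
  have hp2' : p ≠ 2 := by omega
  -- the stable line with its two embeddings
  obtain ⟨L, -, -, ⟨jsub, hjsub, hinjsub, hrsub⟩, ⟨jquot, hjquot, hinjquot, hrquot⟩⟩ :=
    ResidualPairStableLine.exists_stableLine_of_isResidualPairOver (W.baseChange K) hpair
  have hθsub : ∀ σ : absoluteGaloisGroup K, θsub σ ^ (p - 1) = 1 := fun σ ↦ (hpair.pow_sub_one σ).1
  have hθquot : ∀ σ : absoluteGaloisGroup K, θquot σ ^ (p - 1) = 1 := fun σ ↦ (hpair.pow_sub_one σ).2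
  -- the residual strict Selmer groups of `Φ` and `E_K[p]/Φ` are finite
  have hΦ := CharResidualSelmerFinite.finite_residualStrictSelmer_of_forall_dualData θsub κ vbar
    (↑Sf : Set (HeightOneSpectrum (𝓞 K))) hθsub jsub hjsub hinjsub hrsub hγ.out hSsub
  have hΨ := CharResidualSelmerFinite.finite_residualStrictSelmer_of_forall_dualData θquot κ vbar
    (↑Sf : Set (HeightOneSpectrum (𝓞 K))) hθquot jquot hjquot hinjquot hrquot hγ.out hSquot
  -- Brink: `v̄` is finitely decomposed in `K_∞`
  have h𝔭dec : ¬ (decomp vbar ≤ κ.kerSubgroup) :=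
    ZpExtension.decomp_not_le_kerSubgroup_above_of_isAnticyclotomic_holds K p hK hp2' κ hκ vbar hvbar
  -- good reduction off `Sf`
  have hgood : ∀ w : HeightOneSpectrum (𝓞 K), w ∉ (↑Sf : Set (HeightOneSpectrum (𝓞 K))) →
      ((p : ℕ) : 𝓞 K) ∉ w.asIdeal → (W.baseChange K).HasGoodReductionAt w := fun w hw _ ↦
    hasGoodReductionAt_baseChange_of_conductorNorm_notMem W w fun h ↦
      hw (Finset.mem_coe.mpr ((hSf w).mpr h))
  -- the dévissage: `Sel_v̄^{Sf}(K_∞, E[p^∞])[p]` is finite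
  have hfin := ResidualDevissageFiniteKernel.finite_selmerAc_pTorsion_of_line_devissage_of_finite
    (W.baseChange K) κ hvbar h𝔭dec hgood L hΦ hΨ
  have hS : (↑Sf : Set (HeightOneSpectrum (𝓞 K))).Finite := Sf.finite_toSet
  refine ⟨⟨XAc.module_finite κ vbar _ γ hS,
    UniversalToricDescentAcDualMuZero.isTorsion_of_finite_pTorsion (W.baseChange K) p κ vbar _ γ hS hfin,
    UniversalToricDescentAcDualMuZero.muInvariant_eq_zero_of_finite_pTorsion (W.baseChange K) p κ vbar _
      γ hS hfin⟩, ?_⟩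
  obtain ⟨htor0, hμ0⟩ :=
    KellerYinLemma511ResidualFinite.isTorsion_muInvariant_eq_zero_empty_of_residualFinite (W.baseChange K)
      κ vbar γ (↑Sf : Set (HeightOneSpectrum (𝓞 K))) hfin
  exact ⟨XAc.module_finite κ vbar ∅ γ Set.finite_empty, htor0, hμ0⟩

end Summit.BirchSwinnertonDyer.BirchSwinnertonDyer.Theorems.Thm141TorsionClauses

end
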